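import Mathlib
import Summits.MatrixMultiplication.MatrixMultiplication.Theses.LevelGradedCohnUmans
import Literature.NumberTheory.DiophantineGeometry.PartitionTableauxProofs
import Literature.RepresentationTheory.FiniteGroups.VershikKerovMaxDegreeProofs
import Literature.RepresentationTheory.FiniteGroups.VershikKerovLimitShape

/-!
# `SnLevelDesigns` (stmt-MatrixMultiplication-7613), line `garnir-annihilator`: S5g' `stub_nearWallGlue` — the sub-exponential (NearWall) Vershik–Kerov ε-glue

Crux `Summit.MatrixMultiplication.MatrixMultiplication.Theses.LevelGradedCohnUmans.SnLevelDesigns`; skeleton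
`Cruxes/SnLevelDesigns/Lines/garnir-annihilator.lean` (lead reshape 2); this file proves the registered stub `stub_nearWallGlue`
verbatim (name + signature, tree-only vocabulary) and lands `--supports stmt-MatrixMultiplication-7613`.

Statement: FirstRowHooks → ∀ P, NearWall P → ∀ ε > 0, some member of the family satisfies the crux budget inequality, where
NearWall P := ∀ δ > 0, ∀ k₀, ∃ k ≥ k₀, ∃ n X Y Z, 3k ≤ n ∧ P n k X Y Z ∧ D_k(n)^{3/2} ≤ e^{δ√k}·|X||Y||Z|.
Proof (exponential-in-`√k` form of the Vershik–Kerov decay, uniform in `n ≥ 3k`):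
* `nw_core`: with `c := min (log 2) (c₂/2) > 0` (`c₂ = vkUpperConst`), for `k` large, `3k ≤ n`, `j ≤ k`:
  `C(n,j)² · D(j)² · e^{c√k} ≤ C(n,k)² · k!`. Binomial ratio `C(n,j) 2^{k-j} ≤ C(n,k)`
  (`nw_choose_mul_pow_le`); for `2j ≤ k` everything is in `ℕ` (`D(j)² ≤ j! ≤ k!`, `2^k ≤ 4^{k-j}`,
  `nw_core_small`) and `e^{c√k} ≤ e^{(log 2) k} = 2^k`; for `k < 2j` Vershik–Kerov at `ε := c₂/2`
  gives `D(j)² e^{c₂√j} ≤ j! ≤ k!` and `c√k ≤ (c₂/2)(2√j)` (`nw_core_large`).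
* `nw_decay`: with the two first-row-hook bounds, `(f^μ)² ≤ e^{2 - c√k} D_k(n)` on the level window.
* `nw_budget_le` (generic `f : ι → ℕ`): `Σ_{p i}(f i)^{2+ε} ≤ M^{ε/2} Σ_{p i}(f i)²` whenever `(f i)² ≤ M` on `p`;
  here `Σ_{level}(f^μ)^{2+ε} ≤ M^{ε/2} D_k(n)` with `M := e^{2 - c√k} D_k(n)`.
* transfer: `δ := 3cε/(4(2+ε))` (so `δ(2+ε)/3 = cε/4`), `k₀` with `c√k > 4`; then
  `budget ≤ e^{(2-c√k)ε/2} D^{1+ε/2} < e^{-δ√k(2+ε)/3} D^{1+ε/2} = (e^{-δ√k} D^{3/2})^{(2+ε)/3} ≤ V^{(2+ε)/3}`.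
-/

set_option linter.dupNamespace false

namespace Summit.MatrixMultiplication.MatrixMultiplication.Theorems.SnLevelDesigns

open scoped BigOperators

open Literature.NumberTheory.DiophantineGeometry (numStandardTableaux numStandardTableaux_pos_holds)
open Literature.RepresentationTheory.FiniteGroups (maxCharDegree maxCharDegree_sq_le_factorial
  VershikKerov1985_maxCharDegree_holds vkUpperConst vkUpperConst_pos)

/-- Binomial ratio bound: `C(n,j) · 2^{k-j} ≤ C(n,k)` for `j ≤ k` once `3k ≤ n`
(iterate `C(n,j)·2 ≤ C(n,j+1)`, from `C(n,j+1)(j+1) = C(n,j)(n-j)` and `n - j ≥ 2(j+1)`). -/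
theorem nw_choose_mul_pow_le (n k : ℕ) (hn : 3 * k ≤ n) :
    ∀ d j : ℕ, j + d = k → n.choose j * 2 ^ d ≤ n.choose k := by
  intro d
  induction d with
  | zero =>
    intro j hj
    rw [Nat.add_zero] at hj
    rw [hj, pow_zero, mul_one]
  | succ d ih =>
    intro j hj
    have hstep : n.choose j * 2 ≤ n.choose (j + 1) := by
      have h1 : n.choose (j + 1) * (j + 1) = n.choose j * (n - j) := Nat.choose_succ_right_eq n j
      have h2 : 2 * (j + 1) ≤ n - j := by omega
      refine le_of_mul_le_mul_right ?_ (Nat.succ_pos j)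
      calc n.choose j * 2 * (j + 1) = n.choose j * (2 * (j + 1)) := by ring
        _ ≤ n.choose j * (n - j) := Nat.mul_le_mul_left _ h2
        _ = n.choose (j + 1) * (j + 1) := h1.symm
    calc n.choose j * 2 ^ (d + 1) = n.choose j * 2 * 2 ^ d := by ring
      _ ≤ n.choose (j + 1) * 2 ^ d := Nat.mul_le_mul_right _ hstep
      _ ≤ n.choose k := ih (j + 1) (by omega)

/-- Regime `2j ≤ k` of the decay estimate, entirely in `ℕ`:
`C(n,j)² · D(j)² · 2^k ≤ C(n,k)² · k!` (`D(j)² ≤ j! ≤ k!`, `2^k ≤ (2^{k-j})²`). -/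
theorem nw_core_small (n k j : ℕ) (h2j : 2 * j ≤ k) (hn : 3 * k ≤ n) :
    n.choose j ^ 2 * maxCharDegree (Equiv.Perm (Fin j)) ^ 2 * 2 ^ k ≤
      n.choose k ^ 2 * k.factorial := by
  have hc := nw_choose_mul_pow_le n k hn (k - j) j (by omega)
  have hc2 : n.choose j ^ 2 * (2 ^ (k - j)) ^ 2 ≤ n.choose k ^ 2 := by
    rw [← mul_pow]
    exact Nat.pow_le_pow_left hc 2
  have hD : maxCharDegree (Equiv.Perm (Fin j)) ^ 2 ≤ k.factorial :=
    (maxCharDegree_sq_le_factorial j).trans (Nat.factorial_le (by omega))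
  have h2k : 2 ^ k ≤ (2 ^ (k - j)) ^ 2 := by
    rw [← pow_mul]
    exact Nat.pow_le_pow_right (by norm_num) (by omega)
  calc n.choose j ^ 2 * maxCharDegree (Equiv.Perm (Fin j)) ^ 2 * 2 ^ k
      ≤ n.choose j ^ 2 * k.factorial * (2 ^ (k - j)) ^ 2 := by gcongr
    _ = n.choose j ^ 2 * (2 ^ (k - j)) ^ 2 * k.factorial := by ring
    _ ≤ n.choose k ^ 2 * k.factorial := Nat.mul_le_mul_right _ hc2

/-- Regime `k < 2j` of the decay estimate (Vershik–Kerov): there is `k₂` such that for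
`k ≥ k₂` and `j ≤ k < 2j`, `D(j)² · e^{(c₂/2)√k} ≤ k!`. Indeed `D(j)² ≤ j! · e^{-c₂√j}`
(`VershikKerov1985_maxCharDegree_holds` at `ε := c₂/2`, squared) and `√k ≤ 2√j`. -/
theorem nw_core_large : ∃ k₂ : ℕ, ∀ k : ℕ, k₂ ≤ k → ∀ j : ℕ, j ≤ k → k < 2 * j →
    (maxCharDegree (Equiv.Perm (Fin j)) : ℝ) ^ 2 * Real.exp (vkUpperConst / 2 * Real.sqrt k) ≤
      (k.factorial : ℝ) := by
  obtain ⟨n₀, hn₀⟩ :=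
    VershikKerov1985_maxCharDegree_holds (vkUpperConst / 2) (half_pos vkUpperConst_pos)
  have hc : 0 < vkUpperConst := vkUpperConst_pos
  refine ⟨2 * n₀, fun k hk j hjk hkj => ?_⟩
  have hjn₀ : n₀ ≤ j := by omega
  -- Vershik–Kerov, squared
  have hDg : (maxCharDegree (Equiv.Perm (Fin j)) : ℝ) ^ 2 ≤
      (j.factorial : ℝ) * Real.exp (-(vkUpperConst * Real.sqrt j)) := by
    have h0 : (0 : ℝ) ≤ maxCharDegree (Equiv.Perm (Fin j)) := Nat.cast_nonneg _
    calc (maxCharDegree (Equiv.Perm (Fin j)) : ℝ) ^ 2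
        ≤ (Real.sqrt (j.factorial : ℝ) *
            Real.exp (-((vkUpperConst - vkUpperConst / 2) * Real.sqrt (j : ℝ)))) ^ 2 :=
          pow_le_pow_left₀ h0 (hn₀ j hjn₀).2 2
      _ = (j.factorial : ℝ) * Real.exp (-(vkUpperConst * Real.sqrt j)) := by
          rw [mul_pow, Real.sq_sqrt (Nat.cast_nonneg _), ← Real.exp_nat_mul]
          congr 2
          push_cast
          ring
  -- `√k ≤ 2√j`
  have hsqrt : Real.sqrt k ≤ 2 * Real.sqrt j := by
    refine (Real.sqrt_le_left (by positivity)).mpr ?_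
    rw [mul_pow, Real.sq_sqrt (Nat.cast_nonneg _)]
    exact_mod_cast (show k ≤ 2 ^ 2 * j by omega)
  have hexp : Real.exp (vkUpperConst / 2 * Real.sqrt k) ≤
      Real.exp (vkUpperConst * Real.sqrt j) := by
    refine Real.exp_le_exp.mpr ?_
    calc vkUpperConst / 2 * Real.sqrt k ≤ vkUpperConst / 2 * (2 * Real.sqrt j) :=
          mul_le_mul_of_nonneg_left hsqrt (half_pos hc).le
      _ = vkUpperConst * Real.sqrt j := by ring
  have hfac : (j.factorial : ℝ) ≤ k.factorial := by exact_mod_cast Nat.factorial_le hjk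
  have hE : Real.exp (-(vkUpperConst * Real.sqrt j)) * Real.exp (vkUpperConst * Real.sqrt j) = 1 := by
    rw [← Real.exp_add, neg_add_cancel, Real.exp_zero]
  calc (maxCharDegree (Equiv.Perm (Fin j)) : ℝ) ^ 2 * Real.exp (vkUpperConst / 2 * Real.sqrt k)
      ≤ (j.factorial : ℝ) * Real.exp (-(vkUpperConst * Real.sqrt j)) *
          Real.exp (vkUpperConst * Real.sqrt j) := by
        gcongr
    _ = j.factorial := by rw [mul_assoc, hE, mul_one]
    _ ≤ k.factorial := hfac

/-- Both regimes: there are `c > 0` (namely `min (log 2) (c₂/2)`) and `k₁` such that for `k ≥ k₁`,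
`3k ≤ n` and `j ≤ k`, `C(n,j)² · D(j)² · e^{c√k} ≤ C(n,k)² · k!`. -/
theorem nw_core : ∃ c : ℝ, 0 < c ∧ ∃ k₁ : ℕ, ∀ k : ℕ, k₁ ≤ k → ∀ n : ℕ, 3 * k ≤ n →
    ∀ j : ℕ, j ≤ k →
      (n.choose j : ℝ) ^ 2 * (maxCharDegree (Equiv.Perm (Fin j)) : ℝ) ^ 2 *
          Real.exp (c * Real.sqrt k) ≤
        (n.choose k : ℝ) ^ 2 * (k.factorial : ℝ) := by
  obtain ⟨k₂, hk₂⟩ := nw_core_large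
  refine ⟨min (Real.log 2) (vkUpperConst / 2),
    lt_min (Real.log_pos one_lt_two) (half_pos vkUpperConst_pos), k₂, fun k hk n hn j hjk => ?_⟩
  have hk0 : (0 : ℝ) ≤ Real.sqrt k := Real.sqrt_nonneg _
  rcases Nat.lt_or_ge k (2 * j) with hlt | hge
  · -- large `j`: Vershik–Kerov
    have hcj : (n.choose j : ℝ) ≤ n.choose k := by
      have h := nw_choose_mul_pow_le n k hn (k - j) j (by omega)
      exact_mod_cast le_trans (Nat.le_mul_of_pos_right _ (Nat.pow_pos (by norm_num))) h
    have he : Real.exp (min (Real.log 2) (vkUpperConst / 2) * Real.sqrt k) ≤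
        Real.exp (vkUpperConst / 2 * Real.sqrt k) :=
      Real.exp_le_exp.mpr (mul_le_mul_of_nonneg_right (min_le_right _ _) hk0)
    have h := hk₂ k hk j hjk hlt
    calc (n.choose j : ℝ) ^ 2 * (maxCharDegree (Equiv.Perm (Fin j)) : ℝ) ^ 2 *
          Real.exp (min (Real.log 2) (vkUpperConst / 2) * Real.sqrt k)
        ≤ (n.choose k : ℝ) ^ 2 * ((maxCharDegree (Equiv.Perm (Fin j)) : ℝ) ^ 2 *
            Real.exp (vkUpperConst / 2 * Real.sqrt k)) := by
          rw [mul_assoc]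
          gcongr
      _ ≤ (n.choose k : ℝ) ^ 2 * (k.factorial : ℝ) := by gcongr
  · -- small `j`: everything in `ℕ`, and `e^{c√k} ≤ 2^k`
    have hsk : Real.sqrt k ≤ k :=
      (Real.sqrt_le_left (Nat.cast_nonneg k)).mpr (by exact_mod_cast Nat.le_self_pow two_ne_zero k)
    have he : Real.exp (min (Real.log 2) (vkUpperConst / 2) * Real.sqrt k) ≤ (2 : ℝ) ^ k :=
      calc Real.exp (min (Real.log 2) (vkUpperConst / 2) * Real.sqrt k)
          ≤ Real.exp (Real.log 2 * k) :=
            Real.exp_le_exp.mpr (mul_le_mul (min_le_left _ _) hsk hk0 (Real.log_nonneg one_le_two))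
        _ = 2 ^ k := by rw [Real.exp_mul, Real.exp_log two_pos, Real.rpow_natCast]
    have h' : (n.choose j : ℝ) ^ 2 * (maxCharDegree (Equiv.Perm (Fin j)) : ℝ) ^ 2 * (2 : ℝ) ^ k ≤
        (n.choose k : ℝ) ^ 2 * (k.factorial : ℝ) := by
      exact_mod_cast nw_core_small n k j hge hn
    calc (n.choose j : ℝ) ^ 2 * (maxCharDegree (Equiv.Perm (Fin j)) : ℝ) ^ 2 *
          Real.exp (min (Real.log 2) (vkUpperConst / 2) * Real.sqrt k)
        ≤ (n.choose j : ℝ) ^ 2 * (maxCharDegree (Equiv.Perm (Fin j)) : ℝ) ^ 2 * (2 : ℝ) ^ k := by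
          gcongr
      _ ≤ _ := h'

/-- **Decay lemma** (exponential-in-`√k` smallness of the level-`k` degrees against the level
dimension, uniform in `n ≥ 3k`): from the first-row hook bounds there are `c > 0` and `k₁` such that
for `k ≥ k₁`, `3k ≤ n` and every `μ ⊢ n` with `μ₁ ≥ n - k`, `(f^μ)² ≤ e^{2 - c√k} · D_k(n)`. -/
theorem nw_decay
    (h1 : ∀ (n : ℕ) (μ : Nat.Partition n),
      numStandardTableaux μ ≤ n.choose (n - μ.parts.sup) *
        maxCharDegree (Equiv.Perm (Fin (n - μ.parts.sup))))
    (h2 : ∀ (n k : ℕ), 3 * k ≤ n →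
      Real.exp (-2) * ((n.choose k : ℝ) ^ 2 * (k.factorial : ℝ)) ≤
        ((∑ μ : Nat.Partition n, if n - k ≤ μ.parts.sup then
            numStandardTableaux μ ^ 2 else 0 : ℕ) : ℝ)) :
    ∃ c : ℝ, 0 < c ∧ ∃ k₁ : ℕ, ∀ k : ℕ, k₁ ≤ k → ∀ n : ℕ, 3 * k ≤ n → ∀ μ : Nat.Partition n,
      n - k ≤ μ.parts.sup →
        (numStandardTableaux μ : ℝ) ^ 2 ≤ Real.exp (2 - c * Real.sqrt k) *
          ((∑ ν : Nat.Partition n, if n - k ≤ ν.parts.sup then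
              numStandardTableaux ν ^ 2 else 0 : ℕ) : ℝ) := by
  obtain ⟨c, hc, k₁, hk₁⟩ := nw_core
  refine ⟨c, hc, k₁, fun k hk n hn μ hμ => ?_⟩
  have hcore := hk₁ k hk n hn (n - μ.parts.sup) (by omega)
  have hf : (numStandardTableaux μ : ℝ) ≤ (n.choose (n - μ.parts.sup) : ℝ) *
      (maxCharDegree (Equiv.Perm (Fin (n - μ.parts.sup))) : ℝ) := by
    exact_mod_cast h1 n μ
  have hf2 : (numStandardTableaux μ : ℝ) ^ 2 ≤ (n.choose (n - μ.parts.sup) : ℝ) ^ 2 *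
      (maxCharDegree (Equiv.Perm (Fin (n - μ.parts.sup))) : ℝ) ^ 2 := by
    rw [← mul_pow]
    exact pow_le_pow_left₀ (Nat.cast_nonneg _) hf 2
  have hA : (numStandardTableaux μ : ℝ) ^ 2 * Real.exp (c * Real.sqrt k) ≤
      (n.choose k : ℝ) ^ 2 * (k.factorial : ℝ) :=
    le_trans (mul_le_mul_of_nonneg_right hf2 (Real.exp_pos _).le) hcore
  have hB : (n.choose k : ℝ) ^ 2 * (k.factorial : ℝ) ≤ Real.exp 2 *
      ((∑ ν : Nat.Partition n, if n - k ≤ ν.parts.sup then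
          numStandardTableaux ν ^ 2 else 0 : ℕ) : ℝ) := by
    have h := mul_le_mul_of_nonneg_left (h2 n k hn) (Real.exp_pos 2).le
    rwa [← mul_assoc, ← Real.exp_add, show (2 : ℝ) + -2 = 0 by norm_num, Real.exp_zero,
      one_mul] at h
  calc (numStandardTableaux μ : ℝ) ^ 2
      = (numStandardTableaux μ : ℝ) ^ 2 * Real.exp (c * Real.sqrt k) *
          Real.exp (-(c * Real.sqrt k)) := by
        rw [mul_assoc, ← Real.exp_add, add_neg_cancel, Real.exp_zero, mul_one]
    _ ≤ Real.exp 2 * ((∑ ν : Nat.Partition n, if n - k ≤ ν.parts.sup then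
          numStandardTableaux ν ^ 2 else 0 : ℕ) : ℝ) * Real.exp (-(c * Real.sqrt k)) :=
        mul_le_mul_of_nonneg_right (hA.trans hB) (Real.exp_pos _).le
    _ = _ := by
        rw [sub_eq_add_neg, Real.exp_add]
        ring

/-- **Budget factorisation** (generic form): for a positive `f : ι → ℕ`, if `(f i)² ≤ M` whenever
`p i` (on `s`), then `Σ_{i ∈ s, p i} (f i)^{2+ε} ≤ M^{ε/2} · Σ_{i ∈ s, p i} (f i)²`
(`(f i)^{2+ε} = (f i)² · ((f i)²)^{ε/2}`). Used with `f := f^μ` on the level window `μ₁ ≥ n - k`. -/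
theorem nw_budget_le {ι : Type*} (s : Finset ι) (p : ι → Prop) [DecidablePred p] (f : ι → ℕ)
    (hf : ∀ i, 0 < f i) {ε M : ℝ} (hε : 0 ≤ ε) (hle : ∀ i ∈ s, p i → (f i : ℝ) ^ 2 ≤ M) :
    (∑ i ∈ s, if p i then (f i : ℝ) ^ (2 + ε) else 0) ≤
      M ^ (ε / 2) * ((∑ i ∈ s, if p i then f i ^ 2 else 0 : ℕ) : ℝ) := by
  push_cast
  rw [Finset.mul_sum]
  refine Finset.sum_le_sum fun i hi => ?_
  split_ifs with hp
  · have hf0 : (0 : ℝ) < f i := by exact_mod_cast hf i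
    have h2 : ((f i : ℝ) ^ 2) ^ (ε / 2) = (f i : ℝ) ^ ε := by
      rw [← Real.rpow_two, ← Real.rpow_mul hf0.le]
      congr 1
      ring
    rw [Real.rpow_add hf0, Real.rpow_two, ← h2, mul_comm]
    exact mul_le_mul_of_nonneg_right (Real.rpow_le_rpow (by positivity) (hle i hi hp) (by linarith))
      (by positivity)
  · rw [mul_zero]

/-- **`stub_nearWallGlue`** (registered stub S5g' of crux stmt-MatrixMultiplication-7613, line `garnir-annihilator`, lead reshape 2):
the NearWall (sub-exponential slack, `3k ≤ n`) form of the Vershik–Kerov ε-glue. From the first-row hook bounds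
(hypothesis) and a family of level-`k` triples with `3k ≤ n` and `D_k(n)^{3/2} ≤ e^{δ√k} · |X||Y||Z|` for every
`δ > 0` and arbitrarily large `k`, every `ε > 0` has a member with `Σ_{μ₁ ≥ n-k} (f^μ)^{2+ε} < (|X||Y||Z|)^{(2+ε)/3}`
(`nw_decay` + `nw_budget_le` + `rpow` bookkeeping, `δ := 3cε/(4(2+ε))`, `c√k > 4`). -/
theorem stub_nearWallGlue :
    ((∀ (n : ℕ) (μ : Nat.Partition n),
        Literature.NumberTheory.DiophantineGeometry.numStandardTableaux μ ≤ n.choose (n - μ.parts.sup) *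
          Literature.RepresentationTheory.FiniteGroups.maxCharDegree (Equiv.Perm (Fin (n - μ.parts.sup)))) ∧
      (∀ (n k : ℕ), 3 * k ≤ n →
        Real.exp (-2) * ((n.choose k : ℝ) ^ 2 * (k.factorial : ℝ)) ≤
          ((∑ μ : Nat.Partition n, if n - k ≤ μ.parts.sup then
              Literature.NumberTheory.DiophantineGeometry.numStandardTableaux μ ^ 2 else 0 : ℕ) : ℝ))) →
      ∀ P : (n : ℕ) → ℕ → Finset (Equiv.Perm (Fin n)) → Finset (Equiv.Perm (Fin n)) →
          Finset (Equiv.Perm (Fin n)) → Prop,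
        (∀ δ : ℝ, 0 < δ → ∀ k₀ : ℕ, ∃ k : ℕ, k₀ ≤ k ∧ ∃ (n : ℕ) (X Y Z : Finset (Equiv.Perm (Fin n))),
            3 * k ≤ n ∧ P n k X Y Z ∧
              ((∑ μ : Nat.Partition n, if n - k ≤ μ.parts.sup then
                  Literature.NumberTheory.DiophantineGeometry.numStandardTableaux μ ^ 2 else 0 : ℕ) : ℝ) ^ ((3 : ℝ) / 2) ≤
                Real.exp (δ * Real.sqrt (k : ℝ)) * ((X.card * Y.card * Z.card : ℕ) : ℝ)) →
        ∀ ε : ℝ, 0 < ε → ∃ (n k : ℕ) (X Y Z : Finset (Equiv.Perm (Fin n))), P n k X Y Z ∧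
          (∑ μ : Nat.Partition n, if n - k ≤ μ.parts.sup then
              (Literature.NumberTheory.DiophantineGeometry.numStandardTableaux μ : ℝ) ^ (2 + ε) else 0) <
            ((X.card * Y.card * Z.card : ℕ) : ℝ) ^ ((2 + ε) / 3) := by
  rintro ⟨h1, h2⟩ P hNW ε hε
  obtain ⟨c, hc, k₁, hk₁⟩ := nw_decay h1 h2
  -- `δ` with `δ(2+ε)/3 = cε/4`
  set δ : ℝ := 3 * c * ε / (4 * (2 + ε)) with hδ_def
  have hδ : 0 < δ := by positivity
  obtain ⟨k, hk, n, X, Y, Z, h3k, hP, hV⟩ := hNW δ hδ (k₁ + ⌈16 / c ^ 2⌉₊ + 1)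
  refine ⟨n, k, X, Y, Z, hP, ?_⟩
  set D : ℕ := ∑ μ : Nat.Partition n, if n - k ≤ μ.parts.sup then numStandardTableaux μ ^ 2 else 0
    with hD
  -- `c√k > 4`
  have hck : 4 < c * Real.sqrt k := by
    have hk16 : 16 / c ^ 2 < k := by
      have h' : (⌈16 / c ^ 2⌉₊ : ℝ) < k := by exact_mod_cast (show ⌈16 / c ^ 2⌉₊ < k by omega)
      linarith [Nat.le_ceil (16 / c ^ 2)]
    have hsq : 4 / c < Real.sqrt k := by
      refine (Real.lt_sqrt (by positivity)).mpr ?_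
      rwa [div_pow, show (4 : ℝ) ^ 2 = 16 by norm_num]
    calc (4 : ℝ) = c * (4 / c) := by field_simp
      _ < c * Real.sqrt k := mul_lt_mul_of_pos_left hsq hc
  have hDpos : (0 : ℝ) < D := by
    have hlow := h2 n k h3k
    have hcpos : (0 : ℝ) < n.choose k := by exact_mod_cast Nat.choose_pos (by omega)
    have : (0 : ℝ) < Real.exp (-2) * ((n.choose k : ℝ) ^ 2 * (k.factorial : ℝ)) := by positivity
    linarith
  -- the budget is at most `(e^{2 - c√k} D)^{ε/2} · D`
  have hbud : (∑ μ : Nat.Partition n, if n - k ≤ μ.parts.sup then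
      (numStandardTableaux μ : ℝ) ^ (2 + ε) else 0) ≤
        (Real.exp (2 - c * Real.sqrt k) * (D : ℝ)) ^ (ε / 2) * (D : ℝ) :=
    nw_budget_le Finset.univ (fun μ : Nat.Partition n => n - k ≤ μ.parts.sup)
      (fun μ : Nat.Partition n => numStandardTableaux μ) (fun μ => numStandardTableaux_pos_holds μ)
      hε.le (fun μ _ hμ => hk₁ k (by omega) n h3k μ hμ)
  refine lt_of_le_of_lt hbud ?_
  -- the exponent comparison
  have hexp : (2 - c * Real.sqrt k) * (ε / 2) < -(δ * Real.sqrt k) * ((2 + ε) / 3) := by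
    have hδ' : δ * (2 + ε) = 3 * c * ε / 4 := by
      rw [hδ_def]
      field_simp
    have hkey : -(δ * Real.sqrt k) * ((2 + ε) / 3) - (2 - c * Real.sqrt k) * (ε / 2) =
        ε * (c * Real.sqrt k - 4) / 4 := by
      calc -(δ * Real.sqrt k) * ((2 + ε) / 3) - (2 - c * Real.sqrt k) * (ε / 2)
          = -(δ * (2 + ε)) * Real.sqrt k / 3 - (2 - c * Real.sqrt k) * (ε / 2) := by ring
        _ = _ := by rw [hδ']; ring
    have hpos : 0 < ε * (c * Real.sqrt k - 4) / 4 := by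
      have : 0 < c * Real.sqrt k - 4 := by linarith
      positivity
    linarith
  calc (Real.exp (2 - c * Real.sqrt k) * (D : ℝ)) ^ (ε / 2) * (D : ℝ)
      = Real.exp ((2 - c * Real.sqrt k) * (ε / 2)) * (D : ℝ) ^ (1 + ε / 2) := by
        rw [Real.mul_rpow (Real.exp_pos _).le hDpos.le, ← Real.exp_mul, Real.rpow_add hDpos,
          Real.rpow_one]
        ring
    _ < Real.exp (-(δ * Real.sqrt k) * ((2 + ε) / 3)) * (D : ℝ) ^ (1 + ε / 2) :=
        mul_lt_mul_of_pos_right (Real.exp_lt_exp.mpr hexp) (Real.rpow_pos_of_pos hDpos _)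
    _ = (Real.exp (-(δ * Real.sqrt k)) * (D : ℝ) ^ ((3 : ℝ) / 2)) ^ ((2 + ε) / 3) := by
        rw [Real.mul_rpow (Real.exp_pos _).le (Real.rpow_nonneg hDpos.le _), ← Real.exp_mul,
          ← Real.rpow_mul hDpos.le, show (3 : ℝ) / 2 * ((2 + ε) / 3) = 1 + ε / 2 by ring]
    _ ≤ ((X.card * Y.card * Z.card : ℕ) : ℝ) ^ ((2 + ε) / 3) := by
        refine Real.rpow_le_rpow (by positivity) ?_ (by positivity)
        rw [Real.exp_neg, inv_mul_le_iff₀ (Real.exp_pos _)]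
        exact hV

end Summit.MatrixMultiplication.MatrixMultiplication.Theorems.SnLevelDesigns
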